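import Literature.IUT.LogVolume.GenuineLogThetaPerImageSubIndeterminacy
import HarnessLib

/-!
# `−|log(Θ)|` in reading (U) is MONOTONE in the (Ind2)-group too: over a sub-indeterminacy `H` it lies between the hull of the
# (Ind1)-slot union and the container reading, and EQUALS the pure (Ind1)-value when `H` stabilises every translate `x·(R_I)^∼`
# (Dupuy–Hilado §3.9, §4.7, §4.9, §4.11–4.12; [IUTchIII] Cor. 3.12; [IUTchII] Ex. 1.8 (iv))

Proof-only file of the abc-iut cell (WAVE-3 discharge seat abc-iut-c312-d1, gen 10; «C:PERIMAGE-IND2-SEMILINEAR» part 4, the (U)-twin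
of part 3 `GenuineLogThetaPerImageSubIndeterminacy`). TAKES NO SIDE on [IUTchIII] Cor. 3.12.

SETTING. The real prime packet `Q = realPrimePacketWith p 𝔽 c` (any shell), theta idele `t`; at a summand `v⃗ = e` of degree
`j = i+1 ≤ ℓ⋆` the (Ind1)-union of the Θ-regions is the SLOT UNION `M_U = ⋃_a ι_a(t_{i,v_a})·(R_I)^∼` (abc-iut-c312-3,
`realPrimePacketWith_indOneUnion_pilotRegion_eq_slotUnion`), and the cell's `−|log(Θ)|_p` in reading (U) (`Q.negLogThetaAt ℓ⋆ t`) is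
`ln ν̄_{𝕃_p}` of the hull of the FULL-container orbit of `M_U`. For a family `H` of subgroups of the container the (U)-reading over `H` is
`ln ν̄_{𝕃_p}` of `v⃗ ↦ hull(⋃_{g∈H_{v⃗}} g(M_U))` (INLINE):

* `slotUnion_subset_orbitH`, `…_orbitH_slotUnion_subset_possibleImages`, `…_packetAdm_hull_orbitH_slotUnion` —
  `M_U ⊆ ⋃_{g∈H} g(M_U) ⊆` possible images; the `H`-orbit hull is admissible (trapped between the Θ-region and the container hull);
* **`realPrimePacketWith_lnνLp_hull_slotUnion_le_hull_orbitH`**, **`realPrimePacketWith_lnνLp_hull_orbitH_slotUnion_le_negLogThetaAt`** —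
  `ln ν̄_{𝕃_p}(hull(M_U)) ≤ (U)-reading over H ≤ −|log(Θ)|_p`: MONOTONE in the group (F-B28-1 «anti-conservative», reading (U));
* **`realPrimePacketWith_lnνLp_hull_orbitH_slotUnion_eq_of_forall_subset`** — if every `g ∈ H_{v⃗}` maps EVERY translate `x·(R_I)^∼` into
  itself (e.g. unit homotheties `Im(Ẑ^×)`: `…_eq_of_forall_eq_smul`), the (U)-reading over `H` is the pure (Ind1)-value
  `ln ν̄_{𝕃_p}(hull(M_U))` — ZERO (Ind2)-gain; what is left is the slot residue of abc-iut-S8 / s2-p2 (`TensorPacketSlotContent`), which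
  vanishes at slot-constant data (`F_mod = ℚ`).

HONEST WORDS as in parts 1–3: statements about OUR hull functional and OUR container; where print's (Ind2) (factorwise `Ism`, or the
`(Aut(G), Im(Ẑ^×))` of [IUTchII] Rem. 1.11.3 (ii)) sits is reading matter; no side taken; no abc claim. [cite: DupuyHilado2025, §3.9,
§4.7, §4.9, §4.11, §4.12] [cite: Mochizuki2012, IUTchIII Cor. 3.12 p. 174; IUTchII Ex. 1.8 (iv) p. 39, Rem. 1.11.3 (ii) p. 52]
[claim: Mochizuki2012, status: disputed] for every IUT quotation. PROOF-ONLY: no definitions, no new `Prop`.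
-/

noncomputable section

open Set Module NumberField IsDedekindDomain
open scoped Pointwise TensorProduct

namespace Literature.IUT.LogVolume

section RealPacketWith

variable {F : Type} [Field F] [NumberField F]
variable (p : ℕ) [Fact p.Prime] (𝔽 : LocalFields F p)
variable (c : (j : ℕ) → (Fin (j + 1) → placesOver F p) → ℚ_[p]) (hc0 : ∀ j e, c j e ≠ 0)
  (hcσ : ∀ (j : ℕ) (σ : Equiv.Perm (Fin (j + 1))) (e : Fin (j + 1) → placesOver F p), c j (e ∘ σ) = c j e)

/-- The Θ-region `ι_j(t_{i,v_j})·(R_I)^∼` is one slot of the slot union. [cite: DupuyHilado2025, §3.9, §4.7] -/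
theorem realPrimePacketWith_pilotRegion_subset_slotUnion {lstar : ℕ} (t : Fin lstar → (v : placesOver F p) → (𝔽.k v)ˣ)
    (i : Fin lstar) (e : Fin ((i : ℕ) + 1 + 1) → placesOver F p) :
    (realPrimePacketWith p 𝔽 c hc0 hcσ).pilotRegion t ((i : ℕ) + 1) e ⊆
      ⋃ a : Fin ((i : ℕ) + 1 + 1), iota p (fun b => 𝔽.k (e b)) a (t i (e a) : 𝔽.k (e a)) •
        (normalizedPacket p (fun b => 𝔽.k (e b)) : Set (PacketAlgebra p (fun b => 𝔽.k (e b)))) := by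
  rw [realPrimePacketWith_pilotRegion_succ_eq]
  exact Set.subset_iUnion (fun a : Fin ((i : ℕ) + 1 + 1) => iota p (fun b => 𝔽.k (e b)) a
    (t i (e a) : 𝔽.k (e a)) • (normalizedPacket p (fun b => 𝔽.k (e b)) : Set (PacketAlgebra p (fun b => 𝔽.k (e b)))))
    (Fin.last _)

/-- `M_U ⊆ ⋃_{g∈H} g(M_U)` (the identity is in `H`). [cite: DupuyHilado2025, §4.9] -/
theorem slotUnion_subset_orbitH {lstar : ℕ} (t : Fin lstar → (v : placesOver F p) → (𝔽.k v)ˣ)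
    (i : Fin lstar) (e : Fin ((i : ℕ) + 1 + 1) → placesOver F p)
    (H : Subgroup (PacketAlgebra p (fun b => 𝔽.k (e b)) ≃ₗ[ℚ_[p]] PacketAlgebra p (fun b => 𝔽.k (e b)))) :
    (⋃ a : Fin ((i : ℕ) + 1 + 1), iota p (fun b => 𝔽.k (e b)) a (t i (e a) : 𝔽.k (e a)) •
        (normalizedPacket p (fun b => 𝔽.k (e b)) : Set (PacketAlgebra p (fun b => 𝔽.k (e b))))) ⊆
      ⋃ g : H, (g : PacketAlgebra p (fun b => 𝔽.k (e b)) ≃ₗ[ℚ_[p]] PacketAlgebra p (fun b => 𝔽.k (e b))) ''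
        ⋃ a : Fin ((i : ℕ) + 1 + 1), iota p (fun b => 𝔽.k (e b)) a (t i (e a) : 𝔽.k (e a)) •
          (normalizedPacket p (fun b => 𝔽.k (e b)) : Set (PacketAlgebra p (fun b => 𝔽.k (e b)))) := by
  intro x hx
  refine Set.mem_iUnion.mpr ⟨(1 : H), ?_⟩
  have h1 : (((1 : H) : PacketAlgebra p (fun b => 𝔽.k (e b)) ≃ₗ[ℚ_[p]] PacketAlgebra p (fun b => 𝔽.k (e b))) :
      PacketAlgebra p (fun b => 𝔽.k (e b)) → PacketAlgebra p (fun b => 𝔽.k (e b))) = id := by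
    rw [OneMemClass.coe_one, LinearEquiv.coe_one]
  rw [h1]
  exact ⟨x, hx, rfl⟩

/-- `⋃_{g∈H} g(M_U) ⊆` the possible images (the full-container orbit of `M_U`), for `H ≤ indTwo`. [cite: DupuyHilado2025, §4.11] -/
theorem realPrimePacketWith_orbitH_slotUnion_subset_possibleImages {lstar : ℕ}
    (t : Fin lstar → (v : placesOver F p) → (𝔽.k v)ˣ) (i : Fin lstar) (e : Fin ((i : ℕ) + 1 + 1) → placesOver F p)
    (H : Subgroup (PacketAlgebra p (fun b => 𝔽.k (e b)) ≃ₗ[ℚ_[p]] PacketAlgebra p (fun b => 𝔽.k (e b))))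
    (hH : H ≤ indTwo p (fun b => 𝔽.k (e b))) :
    (⋃ g : H, (g : PacketAlgebra p (fun b => 𝔽.k (e b)) ≃ₗ[ℚ_[p]] PacketAlgebra p (fun b => 𝔽.k (e b))) ''
        ⋃ a : Fin ((i : ℕ) + 1 + 1), iota p (fun b => 𝔽.k (e b)) a (t i (e a) : 𝔽.k (e a)) •
          (normalizedPacket p (fun b => 𝔽.k (e b)) : Set (PacketAlgebra p (fun b => 𝔽.k (e b))))) ⊆
      (realPrimePacketWith p 𝔽 c hc0 hcσ).possibleImages ((realPrimePacketWith p 𝔽 c hc0 hcσ).pilotRegion t) ((i : ℕ) + 1) e := by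
  rw [realPrimePacketWith_possibleImages_pilotRegion_eq]
  refine Set.iUnion_subset fun g => ?_
  intro x hx
  refine Set.mem_iUnion.mpr ⟨⟨(g : _ ≃ₗ[ℚ_[p]] _), hH g.2⟩, ?_⟩
  rw [indTwo_smul_set]
  exact hx

/-- `⋃_{g∈H} g(M_U) ⊆ ⋃_{g∈G₂} g·M_U` — the full-container orbit of the slot union (`H ≤ indTwo`). [cite: DupuyHilado2025, §4.9, §4.11] -/
theorem orbitH_slotUnion_subset_orbit {lstar : ℕ}
    (t : Fin lstar → (v : placesOver F p) → (𝔽.k v)ˣ) (i : Fin lstar) (e : Fin ((i : ℕ) + 1 + 1) → placesOver F p)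
    (H : Subgroup (PacketAlgebra p (fun b => 𝔽.k (e b)) ≃ₗ[ℚ_[p]] PacketAlgebra p (fun b => 𝔽.k (e b))))
    (hH : H ≤ indTwo p (fun b => 𝔽.k (e b))) :
    (⋃ g : H, (g : PacketAlgebra p (fun b => 𝔽.k (e b)) ≃ₗ[ℚ_[p]] PacketAlgebra p (fun b => 𝔽.k (e b))) ''
        ⋃ a : Fin ((i : ℕ) + 1 + 1), iota p (fun b => 𝔽.k (e b)) a (t i (e a) : 𝔽.k (e a)) •
          (normalizedPacket p (fun b => 𝔽.k (e b)) : Set (PacketAlgebra p (fun b => 𝔽.k (e b))))) ⊆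
      ⋃ g : indTwo p (fun b => 𝔽.k (e b)),
        g • ⋃ a : Fin ((i : ℕ) + 1 + 1), iota p (fun b => 𝔽.k (e b)) a (t i (e a) : 𝔽.k (e a)) •
          (normalizedPacket p (fun b => 𝔽.k (e b)) : Set (PacketAlgebra p (fun b => 𝔽.k (e b)))) := by
  refine Set.iUnion_subset fun g => ?_
  intro x hx
  refine Set.mem_iUnion.mpr ⟨⟨(g : _ ≃ₗ[ℚ_[p]] _), hH g.2⟩, ?_⟩
  rw [indTwo_smul_set]
  exact hx

/-- The `H`-orbit hull of the slot union is admissible: trapped between the admissible Θ-region `ι_j(t)·(R_I)^∼` and the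
admissible container hull `hull(p^m·log_p(R_I^×))` (`m` the content of the slot union; abc-iut-w5-d180's orbit-content algebra).
[cite: DupuyHilado2025, §4.12] [cite: WeilBNT1967, Ch. II §2, Th. 2] -/
theorem packetAdm_hull_orbitH_slotUnion {lstar : ℕ}
    (t : Fin lstar → (v : placesOver F p) → (𝔽.k v)ˣ) (i : Fin lstar) (e : Fin ((i : ℕ) + 1 + 1) → placesOver F p)
    (H : Subgroup (PacketAlgebra p (fun b => 𝔽.k (e b)) ≃ₗ[ℚ_[p]] PacketAlgebra p (fun b => 𝔽.k (e b))))
    (hH : H ≤ indTwo p (fun b => 𝔽.k (e b))) :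
    PacketAdm p (fun b => 𝔽.k (e b))
      (packetHull p (fun b => 𝔽.k (e b))
        (⋃ g : H, (g : PacketAlgebra p (fun b => 𝔽.k (e b)) ≃ₗ[ℚ_[p]] PacketAlgebra p (fun b => 𝔽.k (e b))) ''
          ⋃ a : Fin ((i : ℕ) + 1 + 1), iota p (fun b => 𝔽.k (e b)) a (t i (e a) : 𝔽.k (e a)) •
            (normalizedPacket p (fun b => 𝔽.k (e b)) : Set (PacketAlgebra p (fun b => 𝔽.k (e b)))))) := by
  obtain ⟨m, hm, hm1⟩ := exists_content p (fun b => 𝔽.k (e b)) (isPsiBounded_slotUnion p 𝔽 t i e)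
    (exists_ne_zero_mem_slotUnion p 𝔽 t i e)
  obtain ⟨x, hxM, hx⟩ := Set.not_subset.mp hm1
  have hcont := packetHull_orbit_eq_zpow p (fun b => 𝔽.k (e b)) hxM hx hm
  refine packetAdm_of_subset_of_subset p (fun b => 𝔽.k (e b))
    (packetAdm_iota_smul p (fun b => 𝔽.k (e b)) (Fin.last _) (t i (e (Fin.last _))).ne_zero
      (packetAdm_normalizedPacket p (fun b => 𝔽.k (e b))))
    (packetAdm_packetHull_zpow_smul_logPacket p (fun b => 𝔽.k (e b)) m) ?_ ?_
  · refine Set.Subset.trans ?_ ((slotUnion_subset_orbitH p 𝔽 t i e H).trans (subset_packetHull p _ _))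
    exact Set.subset_iUnion (fun a : Fin ((i : ℕ) + 1 + 1) => iota p (fun b => 𝔽.k (e b)) a
      (t i (e a) : 𝔽.k (e a)) • (normalizedPacket p (fun b => 𝔽.k (e b)) : Set (PacketAlgebra p (fun b => 𝔽.k (e b)))))
      (Fin.last _)
  · rw [← hcont]
    exact packetHull_mono p _ (orbitH_slotUnion_subset_orbit p 𝔽 t i e H hH)

/-- The hull of the slot union itself (the region of the pure (Ind1)-value) is admissible. [cite: DupuyHilado2025, §4.12] -/
theorem packetAdm_hull_slotUnion {lstar : ℕ}
    (t : Fin lstar → (v : placesOver F p) → (𝔽.k v)ˣ) (i : Fin lstar) (e : Fin ((i : ℕ) + 1 + 1) → placesOver F p) :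
    PacketAdm p (fun b => 𝔽.k (e b))
      (packetHull p (fun b => 𝔽.k (e b))
        (⋃ a : Fin ((i : ℕ) + 1 + 1), iota p (fun b => 𝔽.k (e b)) a (t i (e a) : 𝔽.k (e a)) •
          (normalizedPacket p (fun b => 𝔽.k (e b)) : Set (PacketAlgebra p (fun b => 𝔽.k (e b)))))) := by
  have h := packetAdm_hull_orbitH_slotUnion p 𝔽 t i e (indTwo p (fun b => 𝔽.k (e b))) le_rfl
  have heq : packetHull p (fun b => 𝔽.k (e b))
      (⋃ g : indTwo p (fun b => 𝔽.k (e b)),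
        (g : PacketAlgebra p (fun b => 𝔽.k (e b)) ≃ₗ[ℚ_[p]] PacketAlgebra p (fun b => 𝔽.k (e b))) ''
          ⋃ a : Fin ((i : ℕ) + 1 + 1), iota p (fun b => 𝔽.k (e b)) a (t i (e a) : 𝔽.k (e a)) •
            (normalizedPacket p (fun b => 𝔽.k (e b)) : Set (PacketAlgebra p (fun b => 𝔽.k (e b))))) ⊇
      packetHull p (fun b => 𝔽.k (e b))
        (⋃ a : Fin ((i : ℕ) + 1 + 1), iota p (fun b => 𝔽.k (e b)) a (t i (e a) : 𝔽.k (e a)) •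
          (normalizedPacket p (fun b => 𝔽.k (e b)) : Set (PacketAlgebra p (fun b => 𝔽.k (e b))))) :=
    packetHull_mono p _ (slotUnion_subset_orbitH p 𝔽 t i e (indTwo p (fun b => 𝔽.k (e b))))
  refine packetAdm_of_subset_of_subset p (fun b => 𝔽.k (e b))
    (packetAdm_iota_smul p (fun b => 𝔽.k (e b)) (Fin.last _) (t i (e (Fin.last _))).ne_zero
      (packetAdm_normalizedPacket p (fun b => 𝔽.k (e b)))) h ?_ heq
  exact (Set.subset_iUnion (fun a : Fin ((i : ℕ) + 1 + 1) => iota p (fun b => 𝔽.k (e b)) a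
    (t i (e a) : 𝔽.k (e a)) • (normalizedPacket p (fun b => 𝔽.k (e b)) : Set (PacketAlgebra p (fun b => 𝔽.k (e b)))))
    (Fin.last _)).trans (subset_packetHull p _ _)

/-! ## Monotonicity of the (U)-reading in the group -/

/-- **`ln ν̄_{𝕃_p}(hull of the slot unions) ≤ (U)-reading over H`**. [cite: DupuyHilado2025, §4.11, §4.12] [claim: Mochizuki2012, status: disputed] -/
theorem realPrimePacketWith_lnνLp_hull_slotUnion_le_hull_orbitH {lstar : ℕ}
    (t : Fin lstar → (v : placesOver F p) → (𝔽.k v)ˣ)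
    (H : (j : ℕ) → (e : Fin (j + 1) → placesOver F p) →
      Subgroup (PacketAlgebra p (fun b => 𝔽.k (e b)) ≃ₗ[ℚ_[p]] PacketAlgebra p (fun b => 𝔽.k (e b))))
    (hH : ∀ j e, H j e ≤ indTwo p (fun b => 𝔽.k (e b))) :
    (realPrimePacketWith p 𝔽 c hc0 hcσ).lnνLp lstar (fun j e =>
        packetHull p (fun b => 𝔽.k (e b))
          (⋃ σ : Equiv.Perm (Fin (j + 1)), (realPrimePacketWith p 𝔽 c hc0 hcσ).perm σ e ''
            (realPrimePacketWith p 𝔽 c hc0 hcσ).pilotRegion t j (e ∘ σ))) ≤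
      (realPrimePacketWith p 𝔽 c hc0 hcσ).lnνLp lstar (fun j e =>
        packetHull p (fun b => 𝔽.k (e b))
          (⋃ g : H j e, (g : PacketAlgebra p (fun b => 𝔽.k (e b)) ≃ₗ[ℚ_[p]] PacketAlgebra p (fun b => 𝔽.k (e b))) ''
            ⋃ σ : Equiv.Perm (Fin (j + 1)), (realPrimePacketWith p 𝔽 c hc0 hcσ).perm σ e ''
              (realPrimePacketWith p 𝔽 c hc0 hcσ).pilotRegion t j (e ∘ σ))) := by
  refine (realPrimePacketWith p 𝔽 c hc0 hcσ).lnνLp_mono_of_succ lstar fun i e => ?_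
  have hU : (⋃ σ : Equiv.Perm (Fin ((i : ℕ) + 1 + 1)),
      ((realPrimePacketWith p 𝔽 c hc0 hcσ).perm σ e '' (realPrimePacketWith p 𝔽 c hc0 hcσ).pilotRegion t ((i : ℕ) + 1) (e ∘ σ) :
        Set (PacketAlgebra p (fun b => 𝔽.k (e b))))) =
      ⋃ a : Fin ((i : ℕ) + 1 + 1), iota p (fun b => 𝔽.k (e b)) a (t i (e a) : 𝔽.k (e a)) •
        (normalizedPacket p (fun b => 𝔽.k (e b)) : Set (PacketAlgebra p (fun b => 𝔽.k (e b)))) :=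
    realPrimePacketWith_indOneUnion_pilotRegion_eq_slotUnion p 𝔽 c hc0 hcσ t i e
  show PacketAdm p (fun b => 𝔽.k (e b)) _ ∧ PacketAdm p (fun b => 𝔽.k (e b)) _ ∧ _
  rw [hU]
  exact ⟨packetAdm_hull_slotUnion p 𝔽 t i e, packetAdm_hull_orbitH_slotUnion p 𝔽 t i e (H _ e) (hH _ e),
    packetHull_mono p _ (slotUnion_subset_orbitH p 𝔽 t i e (H _ e))⟩

/-- **`(U)-reading over H ≤ −|log(Θ)|_p`** (the container reading `negLogThetaAt`): reading (U) is MONOTONE in the (Ind2)-group — a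
smaller indeterminacy makes the Θ-side smaller and [IUTchIII] Cor. 3.12 (U) HARDER. [cite: DupuyHilado2025, §4.9, §4.11, §4.12]
[cite: Mochizuki2012, IUTchIII Cor. 3.12 p. 174] [claim: Mochizuki2012, status: disputed] -/
theorem realPrimePacketWith_lnνLp_hull_orbitH_slotUnion_le_negLogThetaAt {lstar : ℕ}
    (t : Fin lstar → (v : placesOver F p) → (𝔽.k v)ˣ)
    (H : (j : ℕ) → (e : Fin (j + 1) → placesOver F p) →
      Subgroup (PacketAlgebra p (fun b => 𝔽.k (e b)) ≃ₗ[ℚ_[p]] PacketAlgebra p (fun b => 𝔽.k (e b))))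
    (hH : ∀ j e, H j e ≤ indTwo p (fun b => 𝔽.k (e b))) :
    (realPrimePacketWith p 𝔽 c hc0 hcσ).lnνLp lstar (fun j e =>
        packetHull p (fun b => 𝔽.k (e b))
          (⋃ g : H j e, (g : PacketAlgebra p (fun b => 𝔽.k (e b)) ≃ₗ[ℚ_[p]] PacketAlgebra p (fun b => 𝔽.k (e b))) ''
            ⋃ σ : Equiv.Perm (Fin (j + 1)), (realPrimePacketWith p 𝔽 c hc0 hcσ).perm σ e ''
              (realPrimePacketWith p 𝔽 c hc0 hcσ).pilotRegion t j (e ∘ σ))) ≤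
      (realPrimePacketWith p 𝔽 c hc0 hcσ).negLogThetaAt lstar t := by
  unfold PrimePacket.negLogThetaAt
  refine (realPrimePacketWith p 𝔽 c hc0 hcσ).lnνLp_mono_of_succ lstar fun i e => ?_
  obtain ⟨m, -, -, -, hadm, -⟩ := realPrimePacketWith_exists_content_logμ_possibleImagesHull p 𝔽 c hc0 hcσ t i e
  have hU : (⋃ σ : Equiv.Perm (Fin ((i : ℕ) + 1 + 1)),
      ((realPrimePacketWith p 𝔽 c hc0 hcσ).perm σ e '' (realPrimePacketWith p 𝔽 c hc0 hcσ).pilotRegion t ((i : ℕ) + 1) (e ∘ σ) :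
        Set (PacketAlgebra p (fun b => 𝔽.k (e b))))) =
      ⋃ a : Fin ((i : ℕ) + 1 + 1), iota p (fun b => 𝔽.k (e b)) a (t i (e a) : 𝔽.k (e a)) •
        (normalizedPacket p (fun b => 𝔽.k (e b)) : Set (PacketAlgebra p (fun b => 𝔽.k (e b)))) :=
    realPrimePacketWith_indOneUnion_pilotRegion_eq_slotUnion p 𝔽 c hc0 hcσ t i e
  show PacketAdm p (fun b => 𝔽.k (e b)) _ ∧ _ ∧ packetHull p (fun b => 𝔽.k (e b)) _ ⊆ packetHull p (fun b => 𝔽.k (e b)) _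
  rw [hU]
  exact ⟨packetAdm_hull_orbitH_slotUnion p 𝔽 t i e (H _ e) (hH _ e), hadm,
    packetHull_mono p _ (realPrimePacketWith_orbitH_slotUnion_subset_possibleImages p 𝔽 c hc0 hcσ t i e (H _ e) (hH _ e))⟩

/-! ## Translate-stabilising sub-indeterminacies: the (U)-reading is the pure (Ind1)-value -/

/-- **ZERO (Ind2)-GAIN IN READING (U)**: if at every summand every `g ∈ H_{v⃗}` maps EVERY translate `x·(R_I)^∼` into itself, the
(U)-reading over `H` equals `ln ν̄_{𝕃_p}` of the hulls of the slot unions (the pure (Ind1)-value: bare value plus slot residue).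
[cite: DupuyHilado2025, §4.7, §4.12] [cite: Mochizuki2012, IUTchII Ex. 1.8 (iv) p. 39] [claim: Mochizuki2012, status: disputed] -/
theorem realPrimePacketWith_lnνLp_hull_orbitH_slotUnion_eq_of_forall_subset {lstar : ℕ}
    (t : Fin lstar → (v : placesOver F p) → (𝔽.k v)ˣ)
    (H : (j : ℕ) → (e : Fin (j + 1) → placesOver F p) →
      Subgroup (PacketAlgebra p (fun b => 𝔽.k (e b)) ≃ₗ[ℚ_[p]] PacketAlgebra p (fun b => 𝔽.k (e b))))
    (hstab : ∀ (j : ℕ) (e : Fin (j + 1) → placesOver F p), ∀ g ∈ H j e, ∀ x : PacketAlgebra p (fun b => 𝔽.k (e b)),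
      (g : PacketAlgebra p (fun b => 𝔽.k (e b)) ≃ₗ[ℚ_[p]] PacketAlgebra p (fun b => 𝔽.k (e b))) ''
          (x • (normalizedPacket p (fun b => 𝔽.k (e b)) : Set (PacketAlgebra p (fun b => 𝔽.k (e b))))) ⊆
        x • (normalizedPacket p (fun b => 𝔽.k (e b)) : Set (PacketAlgebra p (fun b => 𝔽.k (e b))))) :
    (realPrimePacketWith p 𝔽 c hc0 hcσ).lnνLp lstar (fun j e =>
        packetHull p (fun b => 𝔽.k (e b))
          (⋃ g : H j e, (g : PacketAlgebra p (fun b => 𝔽.k (e b)) ≃ₗ[ℚ_[p]] PacketAlgebra p (fun b => 𝔽.k (e b))) ''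
            ⋃ σ : Equiv.Perm (Fin (j + 1)), (realPrimePacketWith p 𝔽 c hc0 hcσ).perm σ e ''
              (realPrimePacketWith p 𝔽 c hc0 hcσ).pilotRegion t j (e ∘ σ))) =
      (realPrimePacketWith p 𝔽 c hc0 hcσ).lnνLp lstar (fun j e =>
        packetHull p (fun b => 𝔽.k (e b))
          (⋃ σ : Equiv.Perm (Fin (j + 1)), (realPrimePacketWith p 𝔽 c hc0 hcσ).perm σ e ''
            (realPrimePacketWith p 𝔽 c hc0 hcσ).pilotRegion t j (e ∘ σ))) := by
  refine (realPrimePacketWith p 𝔽 c hc0 hcσ).lnνLp_congr_of_succ lstar fun i e => ?_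
  have hU : (⋃ σ : Equiv.Perm (Fin ((i : ℕ) + 1 + 1)),
      ((realPrimePacketWith p 𝔽 c hc0 hcσ).perm σ e '' (realPrimePacketWith p 𝔽 c hc0 hcσ).pilotRegion t ((i : ℕ) + 1) (e ∘ σ) :
        Set (PacketAlgebra p (fun b => 𝔽.k (e b))))) =
      ⋃ a : Fin ((i : ℕ) + 1 + 1), iota p (fun b => 𝔽.k (e b)) a (t i (e a) : 𝔽.k (e a)) •
        (normalizedPacket p (fun b => 𝔽.k (e b)) : Set (PacketAlgebra p (fun b => 𝔽.k (e b)))) :=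
    realPrimePacketWith_indOneUnion_pilotRegion_eq_slotUnion p 𝔽 c hc0 hcσ t i e
  show packetHull p (fun b => 𝔽.k (e b)) _ = packetHull p (fun b => 𝔽.k (e b)) _
  rw [hU]
  congr 1
  apply Set.Subset.antisymm
  · refine Set.iUnion_subset fun g => ?_
    rw [Set.image_iUnion]
    exact Set.iUnion_mono fun a => hstab _ e g g.2 _
  · exact slotUnion_subset_orbitH p 𝔽 t i e (H _ e)

/-- **ZERO (Ind2)-GAIN IN READING (U) OVER THE UNIT SCALARS** `Im(Ẑ^×) = ℤ_p^×` (they stabilise every translate,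
`TensorPacketOrbitStable.image_smul_normalizedPacket_eq_of_forall_eq_mul`). [cite: DupuyHilado2025, §4.12]
[cite: Mochizuki2012, IUTchII Ex. 1.8 (iv) p. 39] [claim: Mochizuki2012, status: disputed] -/
theorem realPrimePacketWith_lnνLp_hull_orbitH_slotUnion_eq_of_forall_eq_smul {lstar : ℕ}
    (t : Fin lstar → (v : placesOver F p) → (𝔽.k v)ˣ)
    (H : (j : ℕ) → (e : Fin (j + 1) → placesOver F p) →
      Subgroup (PacketAlgebra p (fun b => 𝔽.k (e b)) ≃ₗ[ℚ_[p]] PacketAlgebra p (fun b => 𝔽.k (e b))))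
    (hH : ∀ j e, ∀ g ∈ H j e, ∃ u : ℚ_[p], ‖u‖ = 1 ∧
      ∀ x, (g : PacketAlgebra p (fun b => 𝔽.k (e b)) ≃ₗ[ℚ_[p]] PacketAlgebra p (fun b => 𝔽.k (e b))) x = u • x) :
    (realPrimePacketWith p 𝔽 c hc0 hcσ).lnνLp lstar (fun j e =>
        packetHull p (fun b => 𝔽.k (e b))
          (⋃ g : H j e, (g : PacketAlgebra p (fun b => 𝔽.k (e b)) ≃ₗ[ℚ_[p]] PacketAlgebra p (fun b => 𝔽.k (e b))) ''
            ⋃ σ : Equiv.Perm (Fin (j + 1)), (realPrimePacketWith p 𝔽 c hc0 hcσ).perm σ e ''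
              (realPrimePacketWith p 𝔽 c hc0 hcσ).pilotRegion t j (e ∘ σ))) =
      (realPrimePacketWith p 𝔽 c hc0 hcσ).lnνLp lstar (fun j e =>
        packetHull p (fun b => 𝔽.k (e b))
          (⋃ σ : Equiv.Perm (Fin (j + 1)), (realPrimePacketWith p 𝔽 c hc0 hcσ).perm σ e ''
            (realPrimePacketWith p 𝔽 c hc0 hcσ).pilotRegion t j (e ∘ σ))) := by
  refine realPrimePacketWith_lnνLp_hull_orbitH_slotUnion_eq_of_forall_subset p 𝔽 c hc0 hcσ t H fun j e g hg x => ?_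
  obtain ⟨u, hu, hgu⟩ := hH j e g hg
  have hu0 : u ≠ 0 := norm_ne_zero_iff.mp (by rw [hu]; exact one_ne_zero)
  have hR : integerPacket p (fun b => 𝔽.k (e b)) ≤ normalizedPacket p (fun b => 𝔽.k (e b)) :=
    integerPacket_le_normalizedPacket p _
  refine (image_smul_normalizedPacket_eq_of_forall_eq_mul p (fun b => 𝔽.k (e b))
    (r := algebraMap ℚ_[p] _ u) (s := algebraMap ℚ_[p] _ u⁻¹)
    (hR (algebraMap_mem_integerPacket p _ hu.le))
    (hR (algebraMap_mem_integerPacket p _ (by rw [norm_inv, hu, inv_one]))) ?_ (fun y => ?_) x).le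
  · rw [← map_mul, mul_inv_cancel₀ hu0, map_one]
  · rw [hgu, Algebra.smul_def]

end RealPacketWith

end Literature.IUT.LogVolume

end
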